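import Summits.QuantumFields.QCD.Theses.GaussianLinkFrames
import Summits.QuantumFields.QCD.Theorems.MobilityGap.Negative.LowerPin
import Summits.QuantumFields.QCD.Cruxes.FMClosureUnquenched.Disproof

/-!
# Disproof of `FrameFMClosure` (stmt-QuantumFields-17375) — standing adversary file

Findings (cycle 1, refuter-cdisprove-stmt-QuantumFields-17375-0, 2026-08-17), indexed.  VERDICT: no kill;
no unconditional refutation is possible in Lean (guard §G); one Negative file proposed, p161260
(`Theorems/FrameFMClosure/Negative/FrameWindow.lean` = §0–§5 below theorem for theorem, there theorem-only
with `Input` written out; here with the abbreviations `Input`, `CoreAt`, `Core`).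

* §0 `Input`, `CoreAt`, `Core`, `frameFMClosure_iff` — the crux is LITERALLY `FrameAPrioriBound → Core`
  and `Core` is byte-identical with the core of the sibling crux `PauliWegnerSea.FMClosureUnquenched`
  (stmt-11512): `core_iff_sibling : Core ↔ FMClosureUnquenched.Disproof.Core := Iff.rfl` (§X).  Hence ALL of
  `Cruxes/FMClosureUnquenched/Disproof.lean` applies verbatim and is CITED, not redone: §2 decoration
  (`core_iff_coreAnyMass`), §3 `N_f = 0`, §4 unit-shell corner (`room_void_at_one`, `core_imp_nnCriterion`,
  `not_abstractFMClosure`), §5 inside the shell (`not_abstractFMClosureRepaired`), §6 `outward_bootstrap`,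
  §7 numerics (16% corner margin), §8 non-vacuity (`oneScaleInput_reg₀`); and the landed
  `VonMisesCirclesC3.outwardGuard_eventually_false` (p154380, divergent physical radius).
* §G GUARD: `refutation_cost : ¬FrameFMClosure → FrameAPrioriBound ∧ ¬Core`; `of_not_apriori` (ex falso);
  cross-route: `fmClosureUnquenched_of_frame` / `frame_of_fmClosureUnquenched` — given their respective
  guards the two closure cruxes 17375 and 11512 are the SAME claim; a refutation of either core kills both
  routes' closure step, a proof of 11512's core supersedes 17375 (route KILL CRITERIA, last bullet).
* §1 HEAVY CORNERS (new, this decl): `upper_of_eventually_heavy` — clause (ii) holds OUTRIGHT on every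
  trajectory eventually in the hopping window `|m_f(k)+4| ≥ 41/10`, at EVERY coupling sequence (landed
  `stub_hopping`); `input_of_heavy_of_bddBeta` — there the one-scale input holds too (bounded `β`).  The
  content of the crux is on the light window `m_f(k) ∈ (-81/10, 1/10)`.
* §2 FRAME WINDOW vs CLAUSE (i) (new, route-specific): `window_dichotomy` — `M > -1 ⇒ |M+4| ≥ 4.1 ∨ M ∈ [-2,2]`;
  so WITH clause (i) every realised mass is eventually covered by hopping or by the `m₀`-range of the
  antecedent (`eventually_frame_or_hopping_of_clauseI`), WITHOUT it (as typed) the light doubler side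
  `(-81/10,-2)` is quantified over with a SILENT antecedent (`light_doubler_side`).  ⇒ refuter R0 (LEAD-1 §3)
  is NECESSARY AND SUFFICIENT for instantiability; as typed, #3 ⊇ 11512's core on the doubler side.
* §3 WITNESSES: `exists_input_above_frameWindow` (M ≡ 3: Input ∧ (i) ∧ masses > 2) and
  `exists_input_below_frameWindow` (M ≡ -10: Input ∧ ¬(i) ∧ masses < -2) — the heavy corners outside the
  frame window are INHABITED (at any constant β), and `Upper` holds on both: no counterexample lives there.
* §4 DECORATION for this decl: `coreAt_iff_anyMass`, `frameFMClosure_iff_anyMass`.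
* §5 CORNERS for this decl: `core_imp_nnCriterion`, `frameFMClosure_corner` (A5; for this route the corner
  is where the frame is TRIVIAL: `β = 0 ⇒ c = 0 ⇒ J ≡ 0 ⇒` conditional law = Haar, antecedent used at
  `B = 0` only); `core_imp_diagonalBound` (A7′: a `β_k`-uniform diagonal bound is asserted for every
  trajectory with Input, while the antecedent's constant is `(1+B)^p`, `B ≍ β_k`).
* §L LINE `Sketch` (= `Lines/defect_ratio_sketch.lean`, idea defect-ratio-tame-line): seven `def : Prop`, no
  stubs, no composition (lead: ineligible, line-dead).  Each Prop attacked cheaply — 0 broken (table in §L).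
  Registered skeleton `Lines/sibling_graft.lean`: stubs = 11512's verbatim; attacks = sibling Disproof
  `-- Targets` (0 broken); `stub_corners` is the misstatement (A5 ∧ A6), not refutable (guard).
* §S SUPPORTS (sanity, by hand): `PlaquetteGaussianFrame` (17376) is TRUE — completing the three Gaussian
  squares gives `exp(β Re tr U_p) = K ∫…` with `K = π^{-27} e^{-6t-6t²}`, `t = √(β/2)` (derivation in §S);
  `TiltedHaarFlatness` (17377) plausible (Laplace on the 8-dim SU(3), density `≲ (1+B)^4`).  The route's
  numerical falsifier (2) for `FrameAPrioriBound` NOT run: the near-deterministic regime (tilt `B → ∞`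
  aligned with a zero-mode configuration) gives only `E|G|^s ≍ (B^{1/2}/V)^s` — polynomial, inside
  `(1+B)^p`; a Monte-Carlo on `8⁴` cannot separate polynomial from super-polynomial growth or certify
  `L`-uniformity; recorded as not informative enough for a shared-queue job.

No `sorry` in this file.
-/

noncomputable section

namespace Summit.QuantumFields.QCD.Cruxes.FrameFMClosure.Disproof

open scoped BigOperators Topology
open MeasureTheory Filter Set
open Literature.MathematicalPhysics.QuantumFieldTheory Literature.MathematicalPhysics.QuantumLattice
  Literature.Probability.LatticeModels
open Summit.QuantumFields.QCD.Theorems.MobilityGapNegative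
open Summit.QuantumFields.QCD.Theses.GaussianLinkFrames

variable {Nf : ℕ}

/-! ### §0 The crux unbundled (definitional re-reading) -/

/-- The ONE-SCALE INPUT of the core (hypothesis of #3 after the antecedent), verbatim over `fm`/`bare`. -/
def Input (reg : QCDRegularisation Nf) (m : Fin Nf → ℝ) : Prop :=
  ∀ q : ℕ, ∃ K₀ s : ℝ, 0 < s ∧ s < 1 ∧ ∀ᶠ k in atTop, ∃ ℓ₀ : ℕ, 1 ≤ ℓ₀ ∧ ℓ₀ ≤ reg.L k ∧
    (ℓ₀ : ℝ) * reg.a k ≤ K₀ * (1 + |Real.log (reg.a k)|) ∧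
    ∀ S : ℕ, reg.L k ≤ S → ∀ (f : Fin Nf) (v : Site 4), v ∈ box 4 S → ‖v‖ = (ℓ₀ : ℝ) →
      (ℓ₀ : ℝ) ^ q * (1 + |reg.β k|) ^ q * fm Nf (reg.β k) (bare reg m k) S f v s ≤ 1

variable (Nf) in
/-- The core at one flavour number: positive masses, `Input ⇒ Upper` for every regularisation. -/
def CoreAt : Prop :=
  ∀ (reg : QCDRegularisation Nf) (m : Fin Nf → ℝ), (∀ f, 0 < m f) → Input reg m → Upper reg m

/-- The unguarded core of #3 (= the core of `PauliWegnerSea.FMClosureUnquenched`, byte for byte). -/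
def Core : Prop := ∀ Nf : ℕ, CoreAt Nf

/-- #3 is LITERALLY `FrameAPrioriBound → Core`. -/
theorem frameFMClosure_iff : FrameFMClosure ↔ (FrameAPrioriBound → Core) := Iff.rfl

/-- What #3 delivers once #2 is in hand. -/
theorem core_of_frameFMClosure (h : FrameFMClosure) (hA : FrameAPrioriBound) : Core :=
  frameFMClosure_iff.1 h hA

/-! ### §1 The heavy corners: the conclusion holds outright, the input is inhabited -/

/-- Eventually `a_k ≤ 1` and `n ≤ L_k`, for every regularisation and every `n`. -/
theorem eventually_a_le_one_and_le_L (reg : QCDRegularisation Nf) (n : ℕ) :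
    ∀ᶠ k in atTop, reg.a k ≤ 1 ∧ n ≤ reg.L k := by
  have ha : ∀ᶠ k in atTop, reg.a k ≤ 1 :=
    (reg.tendsto_a.eventually (gt_mem_nhds one_pos)).mono fun k hk => hk.le
  have hL : ∀ᶠ k in atTop, (n : ℝ) ≤ reg.a k * reg.L k := reg.tendsto_L.eventually_ge_atTop n
  filter_upwards [ha, hL] with k hak hk
  refine ⟨hak, ?_⟩
  have h1 : reg.a k * reg.L k ≤ reg.L k := by
    have := mul_le_mul_of_nonneg_right hak (Nat.cast_nonneg (reg.L k) : (0 : ℝ) ≤ reg.L k)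
    simpa using this
  exact_mod_cast hk.trans h1

/-- **Conclusion on the heavy window.** If the realised bare masses are eventually all in the convergent
hopping window `|m_f(k) + 4| ≥ 41/10`, clause (ii) `Upper` holds — at every coupling sequence, with
`(s, δ, C) = (1/2, 1, 1440)` — by the landed hopping bound.  The core's content is on the light window. -/
theorem upper_of_eventually_heavy (reg : QCDRegularisation Nf) (m : Fin Nf → ℝ)
    (h : ∀ᶠ k in atTop, ∀ f : Fin Nf, (41 / 10 : ℝ) ≤ |bare reg m k f + 4|) : Upper reg m := by
  obtain ⟨C, μ, hC, hμ, hhop⟩ :=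
    Summit.QuantumFields.QCD.Theorems.ThickCollarFarStability.stub_hopping Nf
  refine ⟨1 / 2, 1, C, by norm_num, by norm_num, one_pos, ?_⟩
  have hsmall : ∀ᶠ k in atTop, reg.a k ≤ μ / 2 :=
    reg.tendsto_a.eventually (eventually_le_nhds (by positivity))
  filter_upwards [hsmall, h] with k hk hwin S _ f v hv
  have hb := hhop (reg.β k) (bare reg m k) f (hwin f) S (1 / 2) (by norm_num) (by norm_num) v hv
  refine hb.trans (mul_le_mul_of_nonneg_left (Real.exp_le_exp.2 ?_) hC)
  have hv0 : 0 ≤ ‖v‖ := norm_nonneg _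
  nlinarith

/-- Real analysis: `x^q e^{-c x} → 0` (`c > 0`). -/
theorem tendsto_pow_mul_exp_neg_mul (q : ℕ) {c : ℝ} (hc : 0 < c) :
    Tendsto (fun x : ℝ => x ^ q * Real.exp (-(c * x))) atTop (𝓝 0) := by
  have h1 : Tendsto (fun x : ℝ => (c * x) ^ q * Real.exp (-(c * x))) atTop (𝓝 0) :=
    (Real.tendsto_pow_mul_exp_neg_atTop_nhds_zero q).comp (tendsto_id.const_mul_atTop hc)
  have h2 := h1.const_mul ((c ^ q)⁻¹)
  rw [mul_zero] at h2
  refine h2.congr fun x => ?_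
  have hcq : c ^ q ≠ 0 := pow_ne_zero _ hc.ne'
  rw [mul_pow]
  field_simp

/-- **Input on the heavy window (bounded coupling).** If `|β_k| ≤ β₀` and ALL realised bare masses are in
the hopping window, the one-scale input holds: for each `q` one fixed shell `ℓ₀(q, β₀)` with
`1440 ℓ₀^q (1+β₀)^q e^{-log(41/40) ℓ₀/2} ≤ 1`, `s = 1/2`, `K₀ = ℓ₀`. -/
theorem input_of_heavy_of_bddBeta (reg : QCDRegularisation Nf) (m : Fin Nf → ℝ) (β₀ : ℝ)
    (hβ : ∀ k, |reg.β k| ≤ β₀) (h : ∀ (k : ℕ) (f : Fin Nf), (41 / 10 : ℝ) ≤ |bare reg m k f + 4|) :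
    Input reg m := by
  obtain ⟨C, μ, hC, hμ, hhop⟩ :=
    Summit.QuantumFields.QCD.Theorems.ThickCollarFarStability.stub_hopping Nf
  have hβ₀ : 0 ≤ β₀ := (abs_nonneg _).trans (hβ 0)
  intro q
  -- the shell radius: a natural number ℓ ≥ 1 with ℓ^q (1+β₀)^q C e^{-μ ℓ / 2} ≤ 1
  have hlim : Tendsto (fun x : ℝ => (1 + β₀) ^ q * C * (x ^ q * Real.exp (-(μ / 2 * x)))) atTop (𝓝 0) := by
    have := (tendsto_pow_mul_exp_neg_mul q (c := μ / 2) (by positivity)).const_mul ((1 + β₀) ^ q * C)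
    rwa [mul_zero] at this
  have hev : ∀ᶠ n : ℕ in atTop, (1 + β₀) ^ q * C * ((n : ℝ) ^ q * Real.exp (-(μ / 2 * n))) ≤ 1 :=
    (hlim.comp tendsto_natCast_atTop_atTop).eventually (eventually_le_nhds one_pos)
  obtain ⟨ℓ, hℓ, hℓ1⟩ := (hev.and (eventually_ge_atTop 1)).exists
  refine ⟨ℓ, 1 / 2, by norm_num, by norm_num, ?_⟩
  filter_upwards [eventually_a_le_one_and_le_L reg ℓ] with k hk
  refine ⟨ℓ, hℓ1, hk.2, ?_, ?_⟩
  · -- ℓ a_k ≤ ℓ (1 + |log a_k|)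
    have h0 : 0 ≤ |Real.log (reg.a k)| := abs_nonneg _
    have hℓ0 : (0 : ℝ) ≤ ℓ := Nat.cast_nonneg ℓ
    nlinarith [hk.1]
  · intro S _ f v hv hnorm
    have hb := hhop (reg.β k) (bare reg m k) f (h k f) S (1 / 2) (by norm_num) (by norm_num) v hv
    rw [hnorm] at hb
    have hroom : (0 : ℝ) ≤ (ℓ : ℝ) ^ q * (1 + |reg.β k|) ^ q := by positivity
    have hβk : (1 + |reg.β k|) ^ q ≤ (1 + β₀) ^ q :=
      pow_le_pow_left₀ (by positivity) (by linarith [hβ k]) q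
    calc (ℓ : ℝ) ^ q * (1 + |reg.β k|) ^ q * fm Nf (reg.β k) (bare reg m k) S f v (1 / 2)
        ≤ (ℓ : ℝ) ^ q * (1 + |reg.β k|) ^ q * (C * Real.exp (-(μ * (1 / 2) * ℓ))) :=
          mul_le_mul_of_nonneg_left hb hroom
      _ ≤ (ℓ : ℝ) ^ q * (1 + β₀) ^ q * (C * Real.exp (-(μ * (1 / 2) * ℓ))) := by
          apply mul_le_mul_of_nonneg_right _ (by positivity)
          exact mul_le_mul_of_nonneg_left hβk (by positivity)
      _ = (1 + β₀) ^ q * C * ((ℓ : ℝ) ^ q * Real.exp (-(μ / 2 * ℓ))) := by ring_nf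
      _ ≤ 1 := hℓ

/-- **The core holds on the heavy window** (no input needed): for trajectories eventually in
`|m_f(k)+4| ≥ 41/10` the implication `Input → Upper` is true because its conclusion is. -/
theorem coreAt_of_eventually_heavy (reg : QCDRegularisation Nf) (m : Fin Nf → ℝ)
    (h : ∀ᶠ k in atTop, ∀ f : Fin Nf, (41 / 10 : ℝ) ≤ |bare reg m k f + 4|) :
    Input reg m → Upper reg m :=
  fun _ => upper_of_eventually_heavy reg m h

/-! ### §2 The frame window `[-2, 2]` of the antecedent versus clause (i) -/

/-- **Window dichotomy.** A bare mass on the physical branch `M > -1` is either in the convergent hopping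
window `|M + 4| ≥ 41/10` or in the `m₀`-range `[-2, 2]` of `FrameAPrioriBound`. -/
theorem window_dichotomy {M : ℝ} (h : -1 < M) : (41 / 10 : ℝ) ≤ |M + 4| ∨ (-2 ≤ M ∧ M ≤ 2) := by
  by_cases hM : 1 / 10 ≤ M
  · left
    rw [abs_of_pos (by linarith)]
    linarith
  · right
    push Not at hM
    constructor <;> linarith

/-- With clause (i) every realised bare mass is EVENTUALLY covered: by the hopping bound or by the
antecedent's mass range. -/
theorem eventually_frame_or_hopping_of_clauseI (reg : QCDRegularisation Nf) (m : Fin Nf → ℝ)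
    (h : ClauseI reg m) (f : Fin Nf) :
    ∀ᶠ k in atTop, (41 / 10 : ℝ) ≤ |bare reg m k f + 4| ∨ (-2 ≤ bare reg m k f ∧ bare reg m k f ≤ 2) :=
  (h f).mono fun _ hk => window_dichotomy hk

/-- Without clause (i) there is a LIGHT region outside both: the doubler side `(-81/10, -2)` (e.g. `M = -3`)
is neither in the hopping window nor in the frame window.  #3 as typed quantifies over trajectories living
there, where its antecedent is silent and no landed bound concludes. -/
theorem light_doubler_side :
    ∃ M : ℝ, ¬ ((41 / 10 : ℝ) ≤ |M + 4|) ∧ ¬ (-2 ≤ M ∧ M ≤ 2) :=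
  ⟨-3, by norm_num [abs_of_pos], by norm_num⟩

/-! ### §3 The heavy corners are inhabited (witness trajectories outside the frame window) -/

variable (Nf) in
/-- The constant-parameter sea: `a_k = 1/(k+1)`, `L_k = (k+1)²`, `β ≡ β₀`, `m_crit ≡ M`, `Z_m ≡ 1`. -/
def constReg (M β₀ : ℝ) : QCDRegularisation Nf where
  a := fun k => 1 / ((k : ℝ) + 1)
  a_pos := fun k => by positivity
  tendsto_a := tendsto_one_div_add_atTop_nhds_zero_nat
  β := fun _ => β₀
  L := fun k => (k + 1) ^ 2
  tendsto_L := by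
    have : (fun k : ℕ => (1 : ℝ) / ((k : ℝ) + 1) * (((k + 1) ^ 2 : ℕ) : ℝ)) = fun k : ℕ => (k : ℝ) + 1 := by
      funext k
      push_cast
      have : (k : ℝ) + 1 ≠ 0 := by positivity
      field_simp
    rw [this]
    exact tendsto_atTop_add_const_right _ 1 tendsto_natCast_atTop_atTop
  mcrit := fun _ => M
  Zm := fun _ => 1
  Zm_pos := fun _ => one_pos

/-- The realised bare masses of `constReg M β₀` at `m ≡ 1` lie in `(M, M + 1]`. -/
theorem bare_constReg (M β₀ : ℝ) (k : ℕ) (f : Fin Nf) :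
    M < bare (constReg Nf M β₀) (fun _ => 1) k f ∧ bare (constReg Nf M β₀) (fun _ => 1) k f ≤ M + 1 := by
  have ha : (0 : ℝ) < 1 / ((k : ℝ) + 1) := by positivity
  have ha1 : 1 / ((k : ℝ) + 1) ≤ 1 := by
    rw [div_le_one (by positivity)]
    linarith [(Nat.cast_nonneg k : (0 : ℝ) ≤ k)]
  show M < M + 1 / ((k : ℝ) + 1) * 1 / 1 ∧ M + 1 / ((k : ℝ) + 1) * 1 / 1 ≤ M + 1
  constructor <;> [skip; skip] <;> simp only [mul_one, div_one] <;> linarith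

/-- **Above the window.** A one-flavour trajectory with positive mass, clause (i), the one-scale input and
clause (ii), whose bare masses stay `> 2` for ever: the antecedent `FrameAPrioriBound` (`m₀ ∈ [-2,2]`) is
never instantiable along it (and is not needed: `Upper` holds by hopping). -/
theorem exists_input_above_frameWindow (β₀ : ℝ) :
    ∃ (reg : QCDRegularisation 1) (m : Fin 1 → ℝ), (∀ f, 0 < m f) ∧ (∀ k, reg.β k = β₀) ∧
      ClauseI reg m ∧ Input reg m ∧ Upper reg m ∧ ∀ (k : ℕ) (f : Fin 1), 2 < bare reg m k f := by
  have hwin : ∀ (k : ℕ) (f : Fin 1), (41 / 10 : ℝ) ≤ |bare (constReg 1 3 β₀) (fun _ => 1) k f + 4| := by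
    intro k f
    have := (bare_constReg (Nf := 1) 3 β₀ k f).1
    rw [abs_of_pos (by linarith)]
    linarith
  refine ⟨constReg 1 3 β₀, fun _ => 1, fun _ => one_pos, fun _ => rfl, ?_, ?_, ?_, ?_⟩
  · intro f
    exact Eventually.of_forall fun k => by
      have := (bare_constReg (Nf := 1) 3 β₀ k f).1
      simp only [bare] at this
      linarith
  · exact input_of_heavy_of_bddBeta _ _ |β₀| (fun _ => le_rfl) hwin
  · exact upper_of_eventually_heavy _ _ (Eventually.of_forall fun k f => hwin k f)
  · intro k f
    linarith [(bare_constReg (Nf := 1) 3 β₀ k f).1]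

/-- **Below the window (doubler side).** A one-flavour trajectory with positive mass and the one-scale input
whose bare masses stay `< -2` for ever, violating clause (i): as typed, #3 quantifies over it with a silent
antecedent.  (It is lattice-heavy, `m_f(k) ≤ -9`, so `Upper` holds by hopping — no counterexample; the
uncertifiable part of the doubler side is the LIGHT stretch `(-81/10, -2)`, `light_doubler_side`.) -/
theorem exists_input_below_frameWindow (β₀ : ℝ) :
    ∃ (reg : QCDRegularisation 1) (m : Fin 1 → ℝ), (∀ f, 0 < m f) ∧ (∀ k, reg.β k = β₀) ∧
      ¬ ClauseI reg m ∧ Input reg m ∧ Upper reg m ∧ ∀ (k : ℕ) (f : Fin 1), bare reg m k f < -2 := by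
  have hwin : ∀ (k : ℕ) (f : Fin 1), (41 / 10 : ℝ) ≤ |bare (constReg 1 (-10) β₀) (fun _ => 1) k f + 4| := by
    intro k f
    have := (bare_constReg (Nf := 1) (-10) β₀ k f).2
    rw [abs_of_neg (by linarith)]
    linarith
  refine ⟨constReg 1 (-10) β₀, fun _ => 1, fun _ => one_pos, fun _ => rfl, ?_, ?_, ?_, ?_⟩
  · intro h
    have h0 := (h 0).exists
    obtain ⟨k, hk⟩ := h0
    have := (bare_constReg (Nf := 1) (-10) β₀ k 0).2
    simp only [bare] at this
    linarith
  · exact input_of_heavy_of_bddBeta _ _ |β₀| (fun _ => le_rfl) hwin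
  · exact upper_of_eventually_heavy _ _ (Eventually.of_forall fun k f => hwin k f)
  · intro k f
    linarith [(bare_constReg (Nf := 1) (-10) β₀ k f).2]

/-! ### §4 Decoration: positivity of the renormalised masses is idle (11512 Disproof §2, for this decl) -/

variable (Nf) in
/-- The core at `Nf` with the hypothesis `∀ f, 0 < m f` dropped. -/
def CoreAtAnyMass : Prop :=
  ∀ (reg : QCDRegularisation Nf) (m : Fin Nf → ℝ), Input reg m → Upper reg m

/-- Shifting the flavour-blind critical mass: `mcrit' k = mcrit k - a_k c / Zm k`. -/
def shiftReg (reg : QCDRegularisation Nf) (c : ℝ) : QCDRegularisation Nf where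
  a := reg.a
  a_pos := reg.a_pos
  tendsto_a := reg.tendsto_a
  β := reg.β
  L := reg.L
  tendsto_L := reg.tendsto_L
  mcrit := fun k => reg.mcrit k - reg.a k * c / reg.Zm k
  Zm := reg.Zm
  Zm_pos := reg.Zm_pos

/-- The shifted regularisation realises the original bare masses on the shifted tuple `m + c`. -/
theorem bare_shiftReg (reg : QCDRegularisation Nf) (c : ℝ) (m : Fin Nf → ℝ) (k : ℕ) :
    bare (shiftReg reg c) (fun fl => m fl + c) k = bare reg m k := by
  funext fl
  have hZ : reg.Zm k ≠ 0 := (reg.Zm_pos k).ne'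
  simp only [bare, shiftReg]
  field_simp
  ring

/-- The one-scale input is invariant under the shift. -/
theorem input_shiftReg (reg : QCDRegularisation Nf) (c : ℝ) (m : Fin Nf → ℝ) :
    Input (shiftReg reg c) (fun fl => m fl + c) ↔ Input reg m := by
  unfold Input
  simp only [bare_shiftReg]
  rfl

/-- Clause (ii) is invariant under the shift. -/
theorem upper_shiftReg (reg : QCDRegularisation Nf) (c : ℝ) (m : Fin Nf → ℝ) :
    Upper (shiftReg reg c) (fun fl => m fl + c) ↔ Upper reg m := by
  unfold Upper
  simp only [bare_shiftReg]
  rfl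

/-- **Decoration.** `CoreAt Nf ↔ CoreAtAnyMass Nf`: any real tuple `m` is realised by the positive tuple
`m + c`, `c = 1 + Σ|m_f|`, along the shifted regularisation (`mcrit` is unconstrained data). -/
theorem coreAt_iff_anyMass : CoreAt Nf ↔ CoreAtAnyMass Nf := by
  constructor
  · intro h reg m hin
    set c : ℝ := 1 + ∑ f, |m f| with hc
    have hpos : ∀ f, 0 < m f + c := by
      intro f
      have h1 : |m f| ≤ ∑ g, |m g| :=
        Finset.single_le_sum (f := fun g => |m g|) (fun _ _ => abs_nonneg _) (Finset.mem_univ f)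
      have h2 : -|m f| ≤ m f := neg_abs_le _
      rw [hc]; linarith
    have := h (shiftReg reg c) (fun fl => m fl + c) hpos ((input_shiftReg reg c m).2 hin)
    exact (upper_shiftReg reg c m).1 this
  · intro h reg m _ hin
    exact h reg m hin

/-- #3 with mass positivity dropped is the same statement. -/
theorem frameFMClosure_iff_anyMass :
    FrameFMClosure ↔ (FrameAPrioriBound → ∀ Nf : ℕ, CoreAtAnyMass Nf) := by
  rw [frameFMClosure_iff]
  exact imp_congr_right fun _ => forall_congr' fun _ => coreAt_iff_anyMass

/-! ### §5 The unit-shell corner and the diagonal instance, for this decl -/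

/-- The THRESHOLD-FREE NEAREST-NEIGHBOUR CRITERION (11512 Disproof §4): at `β ≡ 0`, a volume-uniform bound
`≤ 1` on the phase-quenched moment at the 80 sup-norm neighbours of the origin implies physical-rate decay. -/
def NNCriterion : Prop :=
  ∀ (Nf : ℕ) (reg : QCDRegularisation Nf), (∀ k, reg.β k = 0) → ∀ m : Fin Nf → ℝ, (∀ f, 0 < m f) →
    (∃ s : ℝ, 0 < s ∧ s < 1 ∧ ∀ᶠ k in atTop, ∀ S : ℕ, reg.L k ≤ S →
      ∀ (f : Fin Nf) (v : Site 4), v ∈ box 4 S → ‖v‖ = 1 → fm Nf (reg.β k) (bare reg m k) S f v s ≤ 1) →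
    Upper reg m

/-- SOFT CORNER: the core contains `NNCriterion` (input witnessed by `ℓ₀ = 1`, `K₀ = 1`, room factor `1`). -/
theorem core_imp_nnCriterion (h : Core) : NNCriterion := by
  intro Nf reg hβ m hm hnn
  obtain ⟨s, hs0, hs1, hev⟩ := hnn
  refine h Nf reg m hm fun q => ⟨1, s, hs0, hs1, ?_⟩
  filter_upwards [hev, eventually_a_le_one_and_le_L reg 1] with k hk hk'
  refine ⟨1, le_rfl, hk'.2, ?_, ?_⟩
  · have : 0 ≤ |Real.log (reg.a k)| := abs_nonneg _
    push_cast
    nlinarith [hk'.1]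
  · intro S hS f v hv hnorm
    have := hk S hS f v hv (by simpa using hnorm)
    simpa [hβ k] using this

/-- … hence so does #3, given #2.  For THIS route the corner sits where the frame is trivial: at `β = 0` the
Hubbard–Stratonovich tilts vanish (`c = (β/2)^{1/4} = 0`), the conditional link law is Haar, and the antecedent
is used at `B = 0` only. -/
theorem frameFMClosure_corner (h : FrameFMClosure) (hA : FrameAPrioriBound) : NNCriterion :=
  core_imp_nnCriterion (core_of_frameFMClosure h hA)

/-- `0 ∈ box 4 S`. -/
theorem zero_mem_box (S : ℕ) : (0 : Site 4) ∈ box 4 S := by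
  rw [mem_box]; intro i; simp

/-- **Diagonal instance (A7′).** The core asserts, for EVERY trajectory with the one-scale input — whatever
its coupling sequence `β_k` — a `k`-uniform bound on the diagonal phase-quenched moment `fm(·, 0, s) ≤ C`
on all tori `S ≥ L_k`. -/
theorem core_imp_diagonalBound (h : Core) {Nf : ℕ} (reg : QCDRegularisation Nf) (m : Fin Nf → ℝ)
    (hm : ∀ f, 0 < m f) (hin : Input reg m) :
    ∃ s C : ℝ, 0 < s ∧ s < 1 ∧ ∀ᶠ k in atTop, ∀ S : ℕ, reg.L k ≤ S → ∀ f : Fin Nf,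
      fm Nf (reg.β k) (bare reg m k) S f 0 s ≤ C := by
  obtain ⟨s, δ, C, hs0, hs1, -, hev⟩ := h Nf reg m hm hin
  refine ⟨s, C, hs0, hs1, hev.mono fun k hk S hS f => ?_⟩
  simpa using hk S hS f 0 (zero_mem_box S)

-- (workfile-only sections follow)



/-! ### §X Identification with the sibling crux's core (definitional) -/

/-- `Core` here IS the core of `PauliWegnerSea.FMClosureUnquenched` (stmt-11512), term for term. -/
theorem core_iff_sibling :
    Core ↔ Summit.QuantumFields.QCD.Cruxes.FMClosureUnquenched.Disproof.Core := Iff.rfl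

/-! ### §G The guard: what a refutation costs; the two closure cruxes coincide modulo guards -/

/-- REFUTATION COST. A Lean refutation of #3 as filed must PROVE #2 `FrameAPrioriBound` and refute the core. -/
theorem refutation_cost (h : ¬ FrameFMClosure) : FrameAPrioriBound ∧ ¬ Core := by
  rw [frameFMClosure_iff] at h
  by_cases hA : FrameAPrioriBound
  · exact ⟨hA, fun hc => h fun _ => hc⟩
  · exact absurd (fun hA' => absurd hA' hA) h

/-- EX FALSO. A refutation of #2 PROVES #3 (and closes the route at #2, KILL CRITERIA bullet 1). -/
theorem of_not_apriori (h : ¬ FrameAPrioriBound) : FrameFMClosure :=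
  frameFMClosure_iff.2 fun hA => absurd hA h

/-- A proof of the bare core proves #3 (and, below, 11512). -/
theorem of_core (h : Core) : FrameFMClosure := frameFMClosure_iff.2 fun _ => h

/-- CROSS-ROUTE: given #2, #3 implies 11512's `FMClosureUnquenched` (whatever its guards K1, K3). -/
theorem fmClosureUnquenched_of_frame (hA : FrameAPrioriBound) (h : FrameFMClosure) :
    Summit.QuantumFields.QCD.Theses.PauliWegnerSea.FMClosureUnquenched :=
  Summit.QuantumFields.QCD.Cruxes.FMClosureUnquenched.Disproof.fmClosure_iff.2
    fun _ _ => core_iff_sibling.1 (core_of_frameFMClosure h hA)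

/-- CROSS-ROUTE, converse: given 11512's guards, `FMClosureUnquenched` implies #3 (without #2). -/
theorem frame_of_fmClosureUnquenched
    (h1 : Summit.QuantumFields.QCD.Theses.PauliWegnerSea.FibreCofactorDomination)
    (h3 : Summit.QuantumFields.QCD.Theses.PauliWegnerSea.TiltedFlatness)
    (h : Summit.QuantumFields.QCD.Theses.PauliWegnerSea.FMClosureUnquenched) : FrameFMClosure :=
  of_core (core_iff_sibling.2
    (Summit.QuantumFields.QCD.Cruxes.FMClosureUnquenched.Disproof.fmClosure_iff.1 h h1 h3))

/-- NON-VACUITY of the core's hypotheses is the sibling's `oneScaleInput_nonvacuous` (heavy sea `reg₀`,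
unit shell); here additionally at any bounded coupling (§3).  What #3 CLAIMS for the sibling's sea, given #2: -/
theorem decay_reg₀_of_frame (hA : FrameAPrioriBound) (h : FrameFMClosure) :
    Summit.QuantumFields.QCD.Cruxes.FMClosureUnquenched.Disproof.Decay
      Summit.QuantumFields.QCD.Cruxes.FMClosureUnquenched.Disproof.reg₀ (fun _ => 1) :=
  Summit.QuantumFields.QCD.Cruxes.FMClosureUnquenched.Disproof.decay_reg₀_of_core
    (core_iff_sibling.1 (core_of_frameFMClosure h hA))

/-! ### §L Line `Sketch` (payload.line; `Lines/defect_ratio_sketch.lean`) — cheap attacks on its seven Props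

The file has NO stubs and NO composition theorem (lead L0: ineligible; `Lines/Sketch-dead.md`).  Its Props are
hypotheses of `TameCoreOutward`; a FALSE one would make that composition vacuous (misstatement signal), so each
was read for junk and degenerate instances:

| Prop | cheap attacks | verdict |
|---|---|---|
| `DefectRatioBound Nf` (first moment `s = 1` of one entry, `pqE[|det D^{(j←e_i)}|/|det D|] ≤ C(1+|β|)^p`) | `Nf = 0` vacuous-true; `S = 0` (one-site torus) finite; `det = 0` ⇒ `x/0 = 0` harmless; the `|det D_f|` in the weight CANCELS the denominator, so the phase-quenched first moment is a ratio of two absolute partition functions — finite at every `(β, m, S)` (no Anderson-type `E|G| = ∞`); uniformity in `S` and in the UNCONSTRAINED sea masses `mq f'`, `f' ≠ f`, is the content | not cheaply false; physical |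
| `DefectRatioFrac Nf` | as above with `s ≤ s₀ < 1` | not cheaply false |
| `TameApriori Nf` (all `s ∈ (0,1]`) | `s = 1` member = 144 defect ratios; `0^s = 0` fine | not cheaply false |
| `AprioriOfDefect Nf` | Jensen `E X^s ≤ (E X)^s ≤ 1 + E X` under the probability `pqE` | TRUE-looking (provable now) |
| `MixedFarStability Nf` | decoupling `E[XY] ≤ poly (E X^θ + E X) E Y` with `X` depending on ALL links: no product structure under `μ_W·|det|`; `E Y = 0 ⇒ Y = 0` a.e. ⇒ LHS `= 0` (no junk kill); spheres non-empty (`r ≥ 1`) | not cheaply false; crux-grade (= FarStability family) |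
| `DepletedToFullMean Nf` | the Dirichlet (ball-removed) resolvent is NOT protected by the full-torus `|det|` weight, but `s < 1` keeps its moments finite (codimension-1 small singular values); compares two finite quantities | not cheaply false; (Tdec)+(Rout) content |
| `TameCoreOutward` | composition of three open Props into the OUTWARD core; conclusion open | not attackable |

Net: 7 Props, 0 broken.  Registered skeleton `Lines/sibling_graft.lean` (`stub_localCofactorDomination`,
`stub_farStability`, `stub_corners`): identical to 11512's; see sibling Disproof `-- Targets` (0 broken) and
`Lines/sibling-graft-dead.md`.  `stub_corners = (∀ Nf, UnitShellLowerBound Nf) ∧ (∀ Nf reg m>0, InwardExtension Nf reg m)`: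
its first conjunct is TRUE-looking with seam margin `+0.115` (sibling §7/§9 numerics), its second is abstractly
false (`not_abstractFMClosureRepaired`) but concretely unrefutable (needs a non-log-convex radial profile).
-/

/-! ### §S Supports, checked by hand (in the route's cone; not binders)

`PlaquetteGaussianFrame` (stmt-17376).  With `⟨X, Y⟩ := Re tr(X†Y)` on `M₃(ℂ) ≅ ℝ¹⁸` and
`∫ e^{-‖Ψ‖² + 2c⟨K,Ψ⟩} dΨ = π⁹ e^{c²‖K‖²}` (Lebesgue on `ℂ⁹`, Mathlib's `volume`, `∫_ℂ e^{-|z|²} = π`):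
the `Ψ`-integral has `K = U_a + (U_bΦ)†`, `‖K‖² = 3 + ‖Φ‖² + 2 Re tr(U_aU_bΦ)`; the `Ψ'`-integral has
`K' = U_d + (U_cΦ)†`, `‖K'‖² = 3 + ‖Φ‖² + 2 Re tr(U_cΦU_d)`; with `c² = t` the `Φ`-exponent becomes
`-(1+2t)‖Φ‖² + 2t‖Φ‖² + 2t Re tr(WΦ)`, `W = U_aU_b + U_dU_c`, and `∫ e^{-‖Φ‖² + 2t⟨W†,Φ⟩} dΦ = π⁹ e^{t²‖W‖²}`,
`‖W‖² = 6 + 2 Re tr(U_aU_bU_c†U_d†)` (cyclicity, `U⁻¹ = U†`).  Total `π²⁷ e^{6t+6t²} e^{2t² Re tr U_p}` with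
`2t² = β`: the identity holds with `K = π^{-27} e^{-6t-6t²} > 0`.  TRUE (modulo Lean's normalisation of
`volume` on `Fin 3 → Fin 3 → ℂ`, which is the product Lebesgue measure — consistent).

`FrameAPrioriBound` (stmt-17374, the antecedent) — its `p` is load-bearing (the `B`-uniform strengthening `p = 0`
is false on paper): at `m₀ = 0 ∈ [-2,2]` the FREE Wilson–Dirac operator on the torus annihilates the constant
colour–spin vectors (`(D_W ψ)(x) = 4ψ - ½Σ_μ[(1-γ_μ)+(1+γ_μ)]ψ = 0`), so `γ₅D_W(1)` has `0` in its spectrum and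
`(Σ|R_{iη}(1)(x,x)|)^s ≥ (c/(Vη))^s → ∞` as `η → 0`; the tilt field `J ≡ B·1` concentrates the product law at
`U ≡ 1` as `B → ∞` (von Mises–Fisher, angle `≍ B^{-1/2}`), so `sup_B sup_η E_{ν_{B·1}}[(Σ|R_{iη}|)^s] = ∞`
(first `B → ∞` at fixed `η` by weak convergence and continuity of `U ↦ R_{iη}(U)`, then `η → 0`).  Splitting
the 12 zero modes at scale `ε_B ≍ max(B^{-1/2}V^{-1/2}, B^{-1})` gives `E|R(x,x)|^s ≍ (Vε_B)^{-s}`: growth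
polynomial in `B`, inside `(1+B)^p` — consistent with #2 as typed, and the reason the frame mechanism's
constants grow with the coupling (`B ≍ β`), cf. `core_imp_diagonalBound` (A7′).  Not Lean-closable here
(Laplace concentration of the tilted Haar law); recorded for the #2 seats.

`TiltedHaarFlatness` (stmt-17377).  `e^{Re tr U₀J†} ≤ e^{max_U Re tr UJ†}`, and Laplace on the 8-dimensional
`SU(3)` about the maximiser `polar(J)` gives `∫ e^{Re tr UJ†} dHaar ≳ e^{max}(1+B)^{-4}`-ish (Haar small balls of
radius `B^{-1/2}`): plausible with `p = 4`; degenerate `J` (rank < 3) only flattens the peak (helps).  Not attacked further.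
-/

end Summit.QuantumFields.QCD.Cruxes.FrameFMClosure.Disproof

end
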